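import Summits.AtomisticToContinuum.FouriersLaw.Theses.BondHeatUncertainty

/-!
# `BondHeatUncertainty.Assembly` — PROVED

Route `AtomisticToContinuum/FouriersLaw/BondHeatUncertainty`, assembly item
`stmt-AtomisticToContinuum-9657` (`Assembly`):

  `TransferToBoundedResponse → SubdiffusiveBondHeat → ExtensiveSnapshotIrreversibility →
   LinearResponseFTUR → NessUnique → FiniteResponseOfUnique → PositiveOrInfiniteLimit → FouriersLaw`.

The route file carries the planner-authored, sorry-free D-0027 §2.1 deciding theorem
`Summit.AtomisticToContinuum.FouriersLaw.Theses.BondHeatUncertainty.closes`, whose type is literally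
the body of `Assembly`; this file records the item-closing theorem whose type is the route decl
`Assembly` by name.  For the mathematics (bounded response from the transfer glue; clause (i) of
`FouriersLawFor` from the in-tree fact `CuneoEckmannHairerReyBellet2018_pinnedChain_holds` plus
weak-NESS uniqueness; clause (ii) from the `EReal` limit of `D_N` in `(0, +∞]` being bounded by
`sup |D_N| < ⊤`, hence real and positive) see the docstring of `closes` in the route file.
No named-fact hypotheses: the theorem is unconditional (its axioms are those of `closes`:
`propext`, `Classical.choice`, `Quot.sound`).
-/

namespace Summit.AtomisticToContinuum.FouriersLaw.Theorems

/-- Settles `stmt-AtomisticToContinuum-9657` (assembly of route `BondHeatUncertainty`): the transfer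
glue `TransferToBoundedResponse`, the three cruxes `SubdiffusiveBondHeat` (S),
`ExtensiveSnapshotIrreversibility` (K), `LinearResponseFTUR` (★), weak steady-state uniqueness
`NessUnique`, existence of the finite-`N` response limits `FiniteResponseOfUnique` and the import
slot `PositiveOrInfiniteLimit` imply the sub-problem statement `FouriersLaw`.  Proof: the route's
deciding theorem `closes` (after unfolding `Assembly`). [folklore] -/
theorem bondHeatUncertainty_assembly_proof :
    Summit.AtomisticToContinuum.FouriersLaw.Theses.BondHeatUncertainty.Assembly := by
  unfold Summit.AtomisticToContinuum.FouriersLaw.Theses.BondHeatUncertainty.Assembly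
  exact Summit.AtomisticToContinuum.FouriersLaw.Theses.BondHeatUncertainty.closes

end Summit.AtomisticToContinuum.FouriersLaw.Theorems
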